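import Literature.AlgebraicGeometry.Motives.CartierDivisorCocycle
import Literature.AlgebraicGeometry.Motives.SeesawTheorem
import HarnessLib

/-!
# Trivialisations of `ι^*𝒪_X(D)` versus the class pullback `ι^*[D]` for integral `X'`

`Motives/CartierDivisorCocycle` defines, for a Cartier divisor `D = (U_i, f_i)` on an integral
scheme `X` and an arbitrary morphism `ι : X' → X`, trivialisations of the line bundle `ι^*𝒪_X(D)`
in chart form (`CartierDivisor.Trivialization`, units `σ_i` on `ι⁻¹U_i` with
`σ_i = ι^*(f_i/f_j) σ_j`) and the proposition `D.TrivialAlong ι` ("`ι^*𝒪_X(D) ≅ 𝒪_{X'}`").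
`Motives/CartierDivisorClassPullback` defines, for `X'` *integral*, the pullback of the divisor
*class* `ι^*[D] = D.classPullback ι`, a Cartier divisor on `X'` representing `ι^*𝒪_X(D)` under
`DivCl(X') ≅ Pic(X')` (Görtz–Wedhorn I, Prop. 11.21). This file proves that the two languages agree:

* `CartierDivisor.trivialAlong_iff_classPullback_linEquiv_zero`: for `X'` integral,
  `D.TrivialAlong ι ↔ ι^*[D] ∼ 0` — a nowhere-vanishing section of `ι^*𝒪_X(D)` with coordinates
  `σ_i` gives the rational function `σ_{i₀} / ι^♯(f_{i₀}) ∈ K(X')^×` exhibiting `ι^*D` (divisor of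
  the rational section `ι^*1`) as principal, and conversely;
* hence `trivialAlong_id_iff : D.TrivialAlong (𝟙 X) ↔ D ∼ 0` and, for the fibres of a family
  `X ×_K T → T` (`Motives/SeesawTheorem`), `mem_trivialLocus_iff_trivialAlong`:
  `t ∈ Z(D) ↔ D.TrivialAlong ((X × Y)_t → (X × Y) × T)` — the base case of Step (I) in the proof of
  Görtz–Wedhorn II, Lemma 24.72 ("If `A` has length 1, then `A = κ(s)` and `𝓔|_{X_s}` is trivial
  since `s ∈ Z`").

Also: the rational function of a pulled-back section (`RatFn.ofSection_appLE`: `ι^*σ` has rational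
function `ι^♯(σ)`, `RatFn.pullbackFn`), the two directions for divisors avoiding `ι(η_{X'})` in
terms of `CartierDivisor.pullbackAvoiding` (the general case is reduced to this one by moving `D`
off `ι(η_{X'})` inside its class, `trivialAlong_add_principal_iff` of
`Motives/CartierDivisorCocycle`),
and the invariance of `D.TrivialAlong ι` under linear equivalence (`LinEquiv.trivialAlong_iff`).

## References

* U. Görtz, T. Wedhorn, *Algebraic Geometry I: Schemes*, 2nd ed. (2020),
  doi:10.1007/978-3-658-30733-2: Prop. 11.15 / Rem. 11.16, pp. 368–369; (11.9), Prop. 11.21,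
  p. 374; (11.16), Def. 11.49, p. 392 (read via the held copy). [GortzWedhorn2020]
* U. Görtz, T. Wedhorn, *Algebraic Geometry II: Cohomology of Schemes* (2023),
  doi:10.1007/978-3-658-43031-3: Lemma 24.72, proof, Step (I), p. 548. [GortzWedhorn2023]
-/

universe u

open CategoryTheory CategoryTheory.Limits AlgebraicGeometry TopologicalSpace Opposite
open MonoidalCategory CartesianMonoidalCategory

noncomputable section

namespace Literature.AlgebraicGeometry.Motives

namespace RatFn

variable {X X' : Scheme.{u}} [IsIntegral X] (ι : X' ⟶ X)

/-- **The rational function of a pulled-back section**: for `σ ∈ Γ(U, 𝒪_X)` and `V ⊆ ι⁻¹U`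
non-empty, the rational function of `ι^*σ|_V` is `ι^♯(σ) ∈ K(X')` (`RatFn.pullbackFn` of the
rational function of `σ`). [folklore] -/
theorem ofSection_appLE [IsIntegral X'] {U : X.Opens} {V : X'.Opens} (e : V ≤ ι ⁻¹ᵁ U)
    (hV : genericPoint X' ∈ V) (σ : Γ(X, U)) :
    ofSection hV (ι.appLE U V e σ) =
      pullbackFn ι (ofSection (genericPoint_mem_of_mem (show ι (genericPoint X') ∈ U from e hV))
        σ) := by
  have h0 : ι (genericPoint X') ∈ U := e hV
  rw [ofSection_eq_toFunctionField h0 σ, pullbackFn_toFunctionField,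
    Scheme.Hom.germ_stalkMap_apply,
    ← ofSection_eq_toFunctionField (show genericPoint X' ∈ ι ⁻¹ᵁ U from h0)]
  have : ι.appLE U V e σ = X'.presheaf.map (homOfLE e).op (ι.app U σ) := by
    simp only [Scheme.Hom.appLE, CommRingCat.comp_apply]
  rw [this, ofSection_map]

end RatFn

namespace CartierDivisor

open RatFn

variable {X X' : Scheme.{u}} [IsIntegral X] (D : CartierDivisor X) (ι : X' ⟶ X)

/-! ### Divisors avoiding `ι(η_{X'})`: trivialisations versus `pullbackAvoiding` -/

section Avoiding

variable {D ι} [IsIntegral X']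
variable (hD : D.Avoids (ι (genericPoint X')))

include hD in
/-- If `D` avoids `ι(η_{X'})` and `ι^*𝒪_X(D)` has a nowhere-vanishing section with coordinates
`σ_i`, then `ι^*D = (ι⁻¹U_i, ι^♯ f_i)` is principal: `ι^♯(f_i) · (σ_{i₀} / ι^♯ f_{i₀}) = σ_i` is a
unit on `ι⁻¹U_i`. [folklore] -/
theorem pullbackAvoiding_linEquiv_zero_of_trivialization (τ : D.Trivialization ι) :
    (D.pullbackAvoiding ι hD).LinEquiv 0 := by
  obtain ⟨i₀, hi₀⟩ := D.covers (ι (genericPoint X'))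
  have hξ₀ : genericPoint X' ∈ ι ⁻¹ᵁ D.U i₀ := hi₀
  -- the rational function `h = σ_{i₀} / ι^♯ f_{i₀}`
  have hσ₀ : ofSection hξ₀ (τ.σ i₀) ≠ 0 :=
    (isUnitAt_ofSection_of_isUnit (τ.isUnit i₀) hξ₀).ne_zero
  have hf₀ : pullbackFn ι (D.f i₀) ≠ 0 := pullbackFn_ne_zero ι (hD i₀ hi₀)
  rw [linEquiv_iff]
  refine ⟨ofSection hξ₀ (τ.σ i₀) / pullbackFn ι (D.f i₀), div_ne_zero hσ₀ hf₀,
    fun p j y hp _ => ?_⟩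
  rw [zero_f, div_one, pullbackAvoiding_f]
  -- compare with `σ_p` through the cocycle identity at `(p, i₀)`
  have hp' : genericPoint X' ∈ ι ⁻¹ᵁ D.U p.1 := genericPoint_mem_of_mem hp
  have hV : genericPoint X' ∈ ι ⁻¹ᵁ D.U p.1 ⊓ ι ⁻¹ᵁ D.U i₀ := ⟨hp', hξ₀⟩
  have hc := congrArg (ofSection hV) (τ.cocycle p.1 i₀)
  simp only [map_mul, ofSection_map, ofSection_appLE, ofSection_transFun] at hc
  rw [pullbackFn_div ι (hD p.1 p.2).isRegularAt (hD i₀ hi₀)] at hc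
  have he : pullbackFn ι (D.f p.1) * (ofSection hξ₀ (τ.σ i₀) / pullbackFn ι (D.f i₀)) =
      ofSection hp' (τ.σ p.1) := by
    rw [hc]; field_simp
  rw [he]
  exact isUnitAt_ofSection_of_isUnit (τ.isUnit p.1) hp

include hD in
open scoped Classical in
/-- Conversely, if `D` avoids `ι(η_{X'})` and `ι^*D + div(h)` is the zero divisor, then
`σ_i = ι^♯(f_i) · h` are the coordinates of a nowhere-vanishing section of `ι^*𝒪_X(D)`.
[folklore] -/
theorem trivialAlong_of_pullbackAvoiding_linEquiv_zero (H : (D.pullbackAvoiding ι hD).LinEquiv 0) :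
    D.TrivialAlong ι := by
  rw [linEquiv_iff] at H
  obtain ⟨h, hh, H⟩ := H
  have Hu : ∀ (i : D.ι) (hi : ι (genericPoint X') ∈ D.U i) (y : X'), y ∈ ι ⁻¹ᵁ D.U i →
      IsUnitAt y (pullbackFn ι (D.f i) * h) := fun i hi y hy => by
    have := H ⟨i, hi⟩ ⟨⟩ y hy (mem_zero_U _ _)
    rwa [zero_f, div_one, pullbackAvoiding_f] at this
  -- the coordinates
  let σ : ∀ i : D.ι, Γ(X', ι ⁻¹ᵁ D.U i) := fun i =>
    if hi : genericPoint X' ∈ ι ⁻¹ᵁ D.U i then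
      sectionOf hi (pullbackFn ι (D.f i) * h) fun y hy => (Hu i hi y hy).isRegularAt
    else 1
  have hσ : ∀ (i : D.ι) (hi : genericPoint X' ∈ ι ⁻¹ᵁ D.U i),
      ofSection hi (σ i) = pullbackFn ι (D.f i) * h := fun i hi => by
    simp only [σ, dif_pos hi, ofSection_sectionOf]
  have hcocycle : ∀ i j, X'.presheaf.map (homOfLE inf_le_left).op (σ i) =
      ι.appLE (D.U i ⊓ D.U j) (ι ⁻¹ᵁ D.U i ⊓ ι ⁻¹ᵁ D.U j) (D.preimage_inf_le ι i j)
          (D.transFun i j) *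
        X'.presheaf.map (homOfLE inf_le_right).op (σ j) := fun i j => section_ext fun hV => by
    have hi : genericPoint X' ∈ ι ⁻¹ᵁ D.U i := hV.1
    have hj : genericPoint X' ∈ ι ⁻¹ᵁ D.U j := hV.2
    simp only [map_mul, ofSection_map, ofSection_appLE, ofSection_transFun]
    rw [show ofSection ((homOfLE (inf_le_left : ι ⁻¹ᵁ D.U i ⊓ ι ⁻¹ᵁ D.U j ≤ _)).le hV) (σ i) =
        ofSection hi (σ i) from rfl, hσ i hi,
      show ofSection ((homOfLE (inf_le_right : ι ⁻¹ᵁ D.U i ⊓ ι ⁻¹ᵁ D.U j ≤ _)).le hV) (σ j) =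
        ofSection hj (σ j) from rfl, hσ j hj,
      pullbackFn_div ι (hD i hi).isRegularAt (hD j hj)]
    field_simp [pullbackFn_ne_zero ι (hD j hj)]
  have hunit : ∀ i, IsUnit (σ i) := fun i => by
    by_cases hi : genericPoint X' ∈ ι ⁻¹ᵁ D.U i
    · exact isUnit_of_forall_isUnitAt _ fun y hy => by
        rw [show ofSection (genericPoint_mem_of_mem hy) (σ i) = ofSection hi (σ i) from rfl,
          hσ i hi]
        exact Hu i hi y hy
    · simp only [σ, dif_neg hi]
      exact isUnit_one
  exact ⟨{ σ := σ, cocycle := hcocycle, isUnit := hunit }⟩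

include hD in
/-- For `D` avoiding `ι(η_{X'})`: `ι^*𝒪_X(D)` is trivial iff the divisor `ι^*D` is principal.
[folklore] -/
theorem trivialAlong_iff_pullbackAvoiding_linEquiv_zero :
    D.TrivialAlong ι ↔ (D.pullbackAvoiding ι hD).LinEquiv 0 :=
  ⟨fun ⟨τ⟩ => pullbackAvoiding_linEquiv_zero_of_trivialization hD τ,
    trivialAlong_of_pullbackAvoiding_linEquiv_zero hD⟩

end Avoiding

/-! ### The comparison for arbitrary `D` -/

variable [IsIntegral X']

/-- **`ι^*𝒪_X(D) ≅ 𝒪_{X'}` iff `ι^*[D] = 0` in `DivCl(X')`** for a morphism `ι : X' → X` of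
integral schemes: trivialisations in chart form (`CartierDivisor.TrivialAlong`) match triviality
of the class pullback (`CartierDivisor.classPullback`, Görtz–Wedhorn I, Prop. 11.21:
`DivCl ≅ Pic` on the integral scheme `X'`). Move `D` off `ι(η_{X'})` inside its class (same
cocycle) and compare `pullbackAvoiding` with trivialisations. [folklore] -/
theorem trivialAlong_iff_classPullback_linEquiv_zero :
    D.TrivialAlong ι ↔ (D.classPullback ι).LinEquiv 0 := by
  have hD' := D.moveAway_avoids (ι (genericPoint X'))
  rw [← trivialAlong_add_principal_iff (ι := ι) (D := D)
    (D.f (D.covers (ι (genericPoint X'))).choose)⁻¹ (inv_ne_zero (D.f_ne_zero _))]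
  change (D.moveAway (ι (genericPoint X'))).TrivialAlong ι ↔ _
  rw [trivialAlong_iff_pullbackAvoiding_linEquiv_zero hD']
  rfl

/-- `𝒪_X(D)` is trivial (as a line bundle on `X` itself, `ι = 𝟙`) iff `D ∼ 0`. [folklore] -/
theorem trivialAlong_id_iff : D.TrivialAlong (𝟙 X) ↔ D.LinEquiv 0 := by
  rw [trivialAlong_iff_classPullback_linEquiv_zero]
  exact ⟨fun h => (D.classPullback_id_linEquiv.symm).trans h,
    fun h => D.classPullback_id_linEquiv.trans h⟩

/-- `D.TrivialAlong ι` depends only on the class of `D`. [folklore] -/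
theorem LinEquiv.trivialAlong_iff {D E : CartierDivisor X} (hDE : D.LinEquiv E) (ι : X' ⟶ X) :
    D.TrivialAlong ι ↔ E.TrivialAlong ι := by
  rw [trivialAlong_iff_classPullback_linEquiv_zero, trivialAlong_iff_classPullback_linEquiv_zero]
  exact ⟨fun h => (hDE.classPullback ι).symm.trans h, fun h => (hDE.classPullback ι).trans h⟩

end CartierDivisor

/-! ### The trivial locus in terms of trivialisations -/

section TrivialLocus

variable {K : Type u} [Field K] {X T : SchemeOver K} [GeometricallyIntegral X.hom]
  [IsIntegral (X ⊗ T).left]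

/-- **`t ∈ Z(D)` iff `𝒪(D)` is trivial along the fibre `X_t → X ×_K T`** in the chart sense of
`CartierDivisor.TrivialAlong` — the base case `A = κ(s)` of Step (I) in the proof of
Görtz–Wedhorn II, Lemma 24.72. [folklore] -/
theorem CartierDivisor.mem_trivialLocus_iff_trivialAlong {D : CartierDivisor (X ⊗ T).left}
    {t : T.left} :
    t ∈ CartierDivisor.trivialLocus X T D ↔ D.TrivialAlong (X ◁ residuePtι T t).left := by
  rw [CartierDivisor.mem_trivialLocus_iff,
    CartierDivisor.trivialAlong_iff_classPullback_linEquiv_zero]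

end TrivialLocus

end Literature.AlgebraicGeometry.Motives

end
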